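import Literature.AnabelianGeometry.SemiGraphs.PSCRamificationSplitInjection
import Literature.AnabelianGeometry.SemiGraphs.PSCCoveringBranchData
import HarnessLib

/-!
# The corrected split injection at the covering levels `G_U` of a multi-component datum

[IUTchI] Rmk. 1.2.3 (iv) p. 42, verticial half (the split injection `⊕_v M^unr_G[v] ↪ M^unr_G`)
[cite: Mochizuki2012, IUTchI Rmk 1.2.3(iv) p.42], as consumed LEVEL-WISE by the abc-iut [CombGC]
Thm. 1.6 (iii) chain (`PSCThm16iiiAssemblyProofs`, `CoveringsErrataNecessityProofs`,
`PSCVertexQuotient*Proofs`): those files bind the FROZEN predicate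
`(G.restrictBD U hU bd).UnrVerticialSplitInjection` at every finite étale `Π_G`-covering `G_U`.  By
abc-iut finding F-L3t4g5-1 (`PSCUnrVerticialOneVertex.lean`) the frozen predicate is unsatisfiable at
one-vertex sturdy levels; its successor `UnrVerticialSplitInjection'`
(`PSCRamificationSplitInjection.lean`) agrees with it whenever the level has two distinct vertices.
This PROOF-ONLY file supplies the two facts the consumers need to RE-POINT without touching their
statements at multi-component data:

* `nontrivial_restrictBD_vertices` — if `G` has two distinct vertices then so does EVERY covering
  level `G_U` (a vertex of `G_U` lies over each vertex of `G`); likewise `nonempty_restrictBD_vertices`;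
* `UnrVerticialCharacterizationHolds'.restrictBD_of_nontrivial` — hence, at a datum `G` with two
  distinct vertices, the corrected origin statement `UnrVerticialCharacterizationHolds' Ω` yields the
  FROZEN conclusion `(G.restrictBD U hU bd).UnrVerticialSplitInjection ∧ ….ElementaryQuotientVerticiallyRamifiedIff`
  at every level of `Ω`-type — verbatim the binder `hsplit U hU …` of the consumers (one-line swap).

One-vertex data (irreducible curves) are NOT covered: there the smooth case holds outright
(`unrVerticiallyFiltrationPreservingIffVerticial_of_smoothProper`) and the irreducible nodal case is
open on both routes.  No side is taken on [IUTchIII] Cor. 3.12.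
-/

noncomputable section

namespace Literature.AnabelianGeometry.SemiGraphs

namespace PSCDatum

open scoped Pointwise

universe u

variable {P : Type u} [Group P] [TopologicalSpace P] [IsTopologicalGroup P]
variable (G : PSCDatum P) (U : Subgroup P) [U.FiniteIndex] (hU : IsOpen (U : Set P)) (bd : G.BranchData)

/-- **A covering of a datum with a vertex has a vertex.** [cite: MochizukiCombGC2007, Def 1.1(ii) p.6] -/
theorem nonempty_restrictBD_vertices [Nonempty G.graph.V] :
    Nonempty (G.restrictBD U hU bd).graph.V :=
  ⟨G.vertexOver U (Classical.arbitrary G.graph.V) 1⟩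

/-- **A covering of a datum with two distinct vertices has two distinct vertices** (vertices of
`G_U` over distinct vertices of `G` are distinct). [cite: MochizukiCombGC2007, Def 1.1(ii) p.6] -/
theorem nontrivial_restrictBD_vertices [Nontrivial G.graph.V] :
    Nontrivial (G.restrictBD U hU bd).graph.V := by
  obtain ⟨v, w, hvw⟩ := exists_pair_ne G.graph.V
  exact ⟨⟨G.vertexOver U v 1, G.vertexOver U w 1, fun h => hvw (congrArg Sigma.fst h)⟩⟩

/-- **Re-pointing lemma for the consumers of F-1938**: at a datum `G` with two distinct vertices,
the corrected origin statement `UnrVerticialCharacterizationHolds' Ω` ([IUTchI] Rmk. 1.2.3 (iv),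
successor) delivers, at every covering level `G_U` declared of `Ω`-type, the FROZEN conclusion
`UnrVerticialSplitInjection ∧ ElementaryQuotientVerticiallyRamifiedIff` of that level — the binder
the [CombGC] Thm. 1.6 (iii) chain consumes. [cite: Mochizuki2012, IUTchI Rmk 1.2.3(iv) p.42] -/
theorem UnrVerticialCharacterizationHolds'.restrictBD_of_nontrivial {Ω : PSCOrigin.{u}}
    (h : UnrVerticialCharacterizationHolds' Ω) [Nontrivial G.graph.V]
    (hGU : Ω.IsOfPSCType (G.restrictBD U hU bd)) :
    (G.restrictBD U hU bd).UnrVerticialSplitInjection ∧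
      (G.restrictBD U hU bd).ElementaryQuotientVerticiallyRamifiedIff := by
  haveI := G.nontrivial_restrictBD_vertices U hU bd
  exact h.splitInjection_of_nontrivial (G.restrictBD U hU bd) hGU

/-! ### Origins of multi-component data: the frozen origin statement from its successor -/

/-- **At an origin all of whose data have two distinct vertices, the successor origin statement gives
back the FROZEN one** (`UnrVerticialCharacterizationHolds Ω`), so consumers that bind the frozen
statement may keep their theorems verbatim at such origins (e.g. the multi-component part of the
geometric origin, which is closed under passing to covering levels by `nontrivial_restrictBD_vertices`).
[cite: Mochizuki2012, IUTchI Rmk 1.2.3(iv) p.42] -/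
theorem UnrVerticialCharacterizationHolds'.toFrozen_of_nontrivial {Ω : PSCOrigin.{u}}
    (h : UnrVerticialCharacterizationHolds' Ω)
    (hΩ : ∀ ⦃Q : Type u⦄ [Group Q] [TopologicalSpace Q] (G : PSCDatum Q), Ω.IsOfPSCType G →
      Nontrivial G.graph.V) :
    UnrVerticialCharacterizationHolds Ω := fun Q _ _ _ G hG => by
  haveI := hΩ G hG
  exact h.splitInjection_of_nontrivial G hG

/-- The two origin statements are EQUIVALENT at origins of multi-component data.
[cite: Mochizuki2012, IUTchI Rmk 1.2.3(iv) p.42] -/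
theorem unrVerticialCharacterizationHolds'_iff_of_nontrivial {Ω : PSCOrigin.{u}}
    (hΩ : ∀ ⦃Q : Type u⦄ [Group Q] [TopologicalSpace Q] (G : PSCDatum Q), Ω.IsOfPSCType G →
      Nontrivial G.graph.V) :
    UnrVerticialCharacterizationHolds' Ω ↔ UnrVerticialCharacterizationHolds Ω :=
  ⟨fun h => h.toFrozen_of_nontrivial hΩ, fun h => h.toPrime⟩

end PSCDatum

end Literature.AnabelianGeometry.SemiGraphs

end
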